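import Mathlib

/-!
# Sketch — crux `VerticalContact` (stmt-BirchSwinnertonDyer-18431), crux-ideate k=1, round 1

First lemmas of the two crux idea cards (both PROVED here — routine ultrametric
estimates):

* `stub_collapse` — card `arc-rides-weight-line`: the anticyclotomic (`T`-)expansion
  `∑ⱼ aⱼ tʲ` of the two-variable theta element `Θ(x, ·)` at an arithmetic weight `x`,
  evaluated at the arc point `t = ξ̂_N(γ) - 1` (`‖t‖ ≤ ‖x‖`), has the norm of its
  weight-line term `a₀ = Θ(x, 𝟙) = x·β` as soon as `a₁` carries an extra factor `x`
  (`‖a₁‖ ≤ ‖x‖`, i.e. `∂_T Θ(0,0) = 0 ⇔ ord_T θ_∞(E/K) ≥ 2`) and the weight is deep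
  enough (`‖x‖ < ‖β‖`).  In the application `x = (1+p)^{k_N-2} - 1`, `β → 𝓙₀'(2) ≠ 0`.
* `stub_lambdaTwo` — card `lambda-at-weight-2p`: for an Iwasawa function
  `G = ∑ gₙ Xⁿ ∈ ℤ_p⟦X⟧` with `g₀ = g₁ = 0` (here: `L(E,1) = 0` and Kato–Ochiai + corank ≥ 2),
  ONE value of valuation `2` at a point of valuation `1` (the weight `k = 2p` member) forces
  `g₂ ∈ ℤ_p^×` (λ = 2) and hence the exact contact law `‖G(x)‖ = ‖x‖²` on the whole disc.
-/

set_option linter.dupNamespace false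

namespace Summit.BirchSwinnertonDyer.BirchSwinnertonDyer.Cruxes.VerticalContact.ArcWeightLine

open scoped BigOperators

/-- **Ultrametric collapse of the slanted arc onto the weight line** (card
`arc-rides-weight-line`, First lemma).  `a : ℕ → ℤ_[p]` are the `T`-Taylor coefficients of
`Θ(x, T)` at the weight `x`; `a 0 = x * β` is the weight-line value (simple zero at `x = 0`
with cofactor `β`), `‖a 1‖ ≤ ‖x‖` encodes `ord_T θ_∞ ≥ 2`, `t` is the arc point. -/
theorem stub_collapse (p : ℕ) [Fact p.Prime] (a : ℕ → ℤ_[p]) (x t β : ℤ_[p])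
    (h0 : a 0 = x * β) (h1 : ‖a 1‖ ≤ ‖x‖) (ht : ‖t‖ ≤ ‖x‖) (hx : ‖x‖ < ‖β‖) :
    ‖∑' j, a j * t ^ j‖ = ‖x‖ * ‖β‖ := by
  have hβ1 : ‖β‖ ≤ 1 := PadicInt.norm_le_one β
  have hx0 : 0 ≤ ‖x‖ := norm_nonneg x
  have ht0 : 0 ≤ ‖t‖ := norm_nonneg t
  have ht1 : ‖t‖ < 1 := lt_of_le_of_lt ht (lt_of_lt_of_le hx hβ1)
  have hterm : ∀ j, ‖a j * t ^ j‖ ≤ ‖t‖ ^ j := fun j => by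
    rw [norm_mul, norm_pow]
    exact mul_le_of_le_one_left (pow_nonneg ht0 _) (PadicInt.norm_le_one _)
  have hsumm : Summable (fun j => a j * t ^ j) :=
    Summable.of_norm_bounded (summable_geometric_of_lt_one ht0 ht1) hterm
  rw [hsumm.tsum_eq_zero_add, pow_zero, mul_one, h0]
  have htail : ‖∑' b, a (b + 1) * t ^ (b + 1)‖ ≤ ‖x‖ * ‖x‖ := by
    refine IsUltrametricDist.norm_tsum_le_of_forall_le_of_nonneg (mul_nonneg hx0 hx0) fun b => ?_
    rcases b with _ | b
    · rw [zero_add, pow_one, norm_mul]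
      exact mul_le_mul h1 ht ht0 hx0
    · calc ‖a (b + 1 + 1) * t ^ (b + 1 + 1)‖ ≤ ‖t‖ ^ (b + 1 + 1) := hterm _
        _ ≤ ‖t‖ ^ 2 := pow_le_pow_of_le_one ht0 ht1.le (by omega)
        _ ≤ ‖x‖ ^ 2 := pow_le_pow_left₀ ht0 ht 2
        _ = ‖x‖ * ‖x‖ := sq ‖x‖
  by_cases hxz : x = 0
  · subst hxz
    have htl : ∑' b, a (b + 1) * t ^ (b + 1) = 0 := by
      simpa using htail
    simp [htl]
  · have hxpos : 0 < ‖x‖ := norm_pos_iff.mpr hxz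
    have hmain : ‖x * β‖ = ‖x‖ * ‖β‖ := norm_mul _ _
    have hlt : ‖∑' b, a (b + 1) * t ^ (b + 1)‖ < ‖x * β‖ := by
      rw [hmain]
      exact lt_of_le_of_lt htail (mul_lt_mul_of_pos_left hx hxpos)
    rw [IsUltrametricDist.norm_add_eq_max_of_norm_ne_norm (ne_of_gt hlt), max_eq_left hlt.le, hmain]

/-- **λ = 2 is visible at depth zero** (card `lambda-at-weight-2p`, First lemma).
`g : ℕ → ℤ_[p]` are the coefficients of the central-critical weight-line `p`-adic
`L`-function `G(X) = L_p(f_∞; k, k/2)`, `X = (1+p)^{k-2} - 1`; `g 0 = 0` is `L(E,1) = 0`,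
`g 1 = 0` is `ord ≥ 2`; `x₀` is the weight-`2p` point (`‖x₀‖ = p⁻¹`). -/
theorem stub_lambdaTwo (p : ℕ) [Fact p.Prime] (g : ℕ → ℤ_[p]) (h0 : g 0 = 0) (h1 : g 1 = 0)
    (x₀ : ℤ_[p]) (hx₀ : ‖x₀‖ = (p : ℝ)⁻¹)
    (hval : ‖∑' n, g n * x₀ ^ n‖ = ((p : ℝ)⁻¹) ^ 2) :
    ‖g 2‖ = 1 ∧ ∀ x : ℤ_[p], ‖x‖ < 1 → ‖∑' n, g n * x ^ n‖ = ‖x‖ ^ 2 := by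
  have hp1 : (1 : ℝ) < p := by exact_mod_cast (Fact.out : p.Prime).one_lt
  have hp0 : (0 : ℝ) < p := by positivity
  -- generic decomposition: for ‖x‖ < 1 the series is `g 2 * x^2 + tail` with `‖tail‖ ≤ ‖x‖^3`
  have key : ∀ x : ℤ_[p], ‖x‖ < 1 →
      ∑' n, g n * x ^ n = g 2 * x ^ 2 + ∑' n, g (n + 3) * x ^ (n + 3) ∧
      ‖∑' n, g (n + 3) * x ^ (n + 3)‖ ≤ ‖x‖ ^ 3 := by
    intro x hx
    have hx0 : 0 ≤ ‖x‖ := norm_nonneg x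
    have hterm : ∀ n, ‖g n * x ^ n‖ ≤ ‖x‖ ^ n := fun n => by
      rw [norm_mul, norm_pow]
      exact mul_le_of_le_one_left (pow_nonneg hx0 _) (PadicInt.norm_le_one _)
    have hsumm : Summable (fun n => g n * x ^ n) :=
      Summable.of_norm_bounded (summable_geometric_of_lt_one hx0 hx) hterm
    refine ⟨?_, ?_⟩
    · rw [← hsumm.sum_add_tsum_nat_add 3]
      simp [Finset.sum_range_succ, h0, h1]
    · refine IsUltrametricDist.norm_tsum_le_of_forall_le_of_nonneg (pow_nonneg hx0 3) fun n => ?_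
      exact (hterm _).trans (pow_le_pow_of_le_one hx0 hx.le (by omega))
  -- Step 1: `g 2` is a unit
  have hx₀lt : ‖x₀‖ < 1 := by rw [hx₀]; exact inv_lt_one_of_one_lt₀ hp1
  obtain ⟨hdec, htail⟩ := key x₀ hx₀lt
  have hg2 : ‖g 2‖ = 1 := by
    by_contra hne
    have hlt1 : ‖g 2‖ < 1 := lt_of_le_of_ne (PadicInt.norm_le_one _) hne
    -- then ‖g 2‖ ≤ p⁻¹
    have hle : ‖g 2‖ ≤ (p : ℝ)⁻¹ := by
      rcases eq_or_ne (g 2) 0 with h | h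
      · rw [h, norm_zero]; positivity
      · exact (PadicInt.norm_lt_one_iff_dvd _ |>.mp hlt1) |> fun hd =>
          (PadicInt.norm_le_pow_iff_mem_span_pow _ 1 |>.mpr (by simpa [Ideal.mem_span_singleton] using hd)).trans
            (by simp)
    have hmain : ‖g 2 * x₀ ^ 2‖ ≤ (p : ℝ)⁻¹ ^ 3 := by
      rw [norm_mul, norm_pow, hx₀]
      calc ‖g 2‖ * (p : ℝ)⁻¹ ^ 2 ≤ (p : ℝ)⁻¹ * (p : ℝ)⁻¹ ^ 2 :=
            mul_le_mul_of_nonneg_right hle (by positivity)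
        _ = (p : ℝ)⁻¹ ^ 3 := by ring
    have hall : ‖∑' n, g n * x₀ ^ n‖ ≤ (p : ℝ)⁻¹ ^ 3 := by
      rw [hdec]
      refine (IsUltrametricDist.norm_add_le_max _ _).trans (max_le hmain ?_)
      rw [hx₀] at htail; exact htail
    rw [hval] at hall
    have : (p : ℝ)⁻¹ ^ 2 ≤ (p : ℝ)⁻¹ ^ 3 := hall
    have hlt : (p : ℝ)⁻¹ ^ 3 < (p : ℝ)⁻¹ ^ 2 :=
      pow_lt_pow_right_of_lt_one₀ (by positivity) (inv_lt_one_of_one_lt₀ hp1) (by norm_num)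
    exact absurd this (not_le.mpr hlt)
  refine ⟨hg2, fun x hx => ?_⟩
  obtain ⟨hdecx, htailx⟩ := key x hx
  rw [hdecx]
  have hx0 : 0 ≤ ‖x‖ := norm_nonneg x
  have hmainx : ‖g 2 * x ^ 2‖ = ‖x‖ ^ 2 := by rw [norm_mul, norm_pow, hg2, one_mul]
  by_cases hxz : x = 0
  · subst hxz
    simp
  · have hxpos : 0 < ‖x‖ := norm_pos_iff.mpr hxz
    have hlt : ‖∑' n, g (n + 3) * x ^ (n + 3)‖ < ‖g 2 * x ^ 2‖ := by
      rw [hmainx]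
      exact lt_of_le_of_lt htailx (pow_lt_pow_right_of_lt_one₀ hxpos hx (by norm_num))
    rw [IsUltrametricDist.norm_add_eq_max_of_norm_ne_norm (ne_of_gt hlt), max_eq_left hlt.le, hmainx]

/-- Sanity instance of the collapse mechanism with everything explicit (no `tsum`):
a three-term expansion.  Proved, to certify the inequalities are the right way round. -/
theorem collapse_three_terms (p : ℕ) [Fact p.Prime] (a₁ a₂ x t β : ℤ_[p])
    (h1 : ‖a₁‖ ≤ ‖x‖) (ht : ‖t‖ ≤ ‖x‖) (hx : ‖x‖ < ‖β‖) :
    ‖x * β + a₁ * t + a₂ * t ^ 2‖ = ‖x‖ * ‖β‖ := by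
  have hβ1 : ‖β‖ ≤ 1 := PadicInt.norm_le_one β
  have ha₂ : ‖a₂‖ ≤ 1 := PadicInt.norm_le_one a₂
  have hx0 : 0 ≤ ‖x‖ := norm_nonneg x
  have ht0 : 0 ≤ ‖t‖ := norm_nonneg t
  -- the two correction terms are strictly smaller than the main term (or everything is 0)
  by_cases hxz : x = 0
  · subst hxz
    have : a₁ = 0 := by simpa using h1
    subst this
    have : t = 0 := by simpa using ht
    subst this
    simp
  · have hxpos : 0 < ‖x‖ := norm_pos_iff.mpr hxz
    have hmain : ‖x * β‖ = ‖x‖ * ‖β‖ := by rw [norm_mul]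
    have hc1 : ‖a₁ * t‖ < ‖x‖ * ‖β‖ := by
      rw [norm_mul]
      calc ‖a₁‖ * ‖t‖ ≤ ‖x‖ * ‖x‖ := mul_le_mul h1 ht ht0 hx0
        _ < ‖x‖ * ‖β‖ := mul_lt_mul_of_pos_left hx hxpos
    have hc2 : ‖a₂ * t ^ 2‖ < ‖x‖ * ‖β‖ := by
      rw [norm_mul, norm_pow]
      calc ‖a₂‖ * ‖t‖ ^ 2 ≤ 1 * ‖x‖ ^ 2 := by
            apply mul_le_mul ha₂ (pow_le_pow_left₀ ht0 ht 2) (by positivity) (by norm_num)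
        _ = ‖x‖ * ‖x‖ := by ring
        _ < ‖x‖ * ‖β‖ := mul_lt_mul_of_pos_left hx hxpos
    have hsum : ‖a₁ * t + a₂ * t ^ 2‖ < ‖x * β‖ := by
      rw [hmain]
      calc ‖a₁ * t + a₂ * t ^ 2‖ ≤ max ‖a₁ * t‖ ‖a₂ * t ^ 2‖ :=
            IsUltrametricDist.norm_add_le_max _ _
        _ < ‖x‖ * ‖β‖ := max_lt hc1 hc2
    calc ‖x * β + a₁ * t + a₂ * t ^ 2‖ = ‖x * β + (a₁ * t + a₂ * t ^ 2)‖ := by ring_nf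
      _ = ‖x * β‖ := IsUltrametricDist.norm_add_eq_max_of_norm_ne_norm
            (by exact (ne_of_gt hsum)) |>.trans (max_eq_left hsum.le)
      _ = ‖x‖ * ‖β‖ := hmain

end Summit.BirchSwinnertonDyer.BirchSwinnertonDyer.Cruxes.VerticalContact.ArcWeightLine
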